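import Summits.QuantumAdvantage.QuantumAdvantage.Theorems.WbwObfuscatedGluedTreesKowRiVocabulary

/-!
# The generator is ideal-model-II code run at its own tables (stub `stub_codeLink`)

Crux `WbwObfuscatedGluedTrees` (stmt-QuantumAdvantage-2340), line `knowledge-of-walk-split`, STAGE 6 (the real→ideal
statistical layer).  Ideal model II runs the generator's OWN naming / Feistel code (`naming`, `cycleOf` of
`Literature/Computability/Cryptography/ObfuscatedGluedTrees.lean`) through the table scheme `tabScheme H⃗` over four
`μ`-bit tables.  This file proves conjunct (ii) of the stage-6 target: at the four tables `v ↦ F_{kᵢ}(v)` of the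
generator's own keys (`tablesOf P μ k₁ k₂ k₃ k₄`) and in the region `2d + 3 ≤ μ`, `d ≤ μ` (so that no `fit` truncates a
PRF value below the length at which it is read), the code naming IS the generator's naming and the code cycle IS the
generator's cycle datum:

* the key identity `prf (tabScheme (tablesOf …)) μ (tkey i) m x = prf P μ kᵢ m x` for `m ≤ μ` (`prf_tablesOf`): both
  sides are `fit m` of `F_{kᵢ}` at the `μ`-bit fitting of `x`, the left one through a harmless intermediate `fit μ`;
* the naming: every PRF call of `vname = sivEnc ∘ label` is such a `prf` with `m = μ` (tag) or `m = 2d + 3` (mask);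
* the cycle: every PRF call of the round functions `roundFn` of `prp` is such a `prf` with `m = d`.

So the only remaining real→ideal step is the replacement of the four tables of PRF keys by uniform tables (stage 7).
-/

set_option linter.dupNamespace false

noncomputable section

namespace Summit.QuantumAdvantage.QuantumAdvantage.Theorems.WbwObfuscatedGluedTrees.KnowledgeOfWalk.RealIdeal

open Literature.Computability.Complexity Literature.Computability.QuantumComplexity
open Literature.Computability.QuantumComplexity.GluedTrees
open Literature.Computability.Cryptography Literature.Computability.Cryptography.ObfuscatedGluedTrees
open Summit.QuantumAdvantage.QuantumAdvantage.Theorems.WbwObfuscatedGluedTrees.KnowledgeOfWalk.BlackBox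

/-- **The key identity.** Reading table `i` of the generator's own tables through the table scheme is calling the
generator's fitted PRF at key `kᵢ`, at every output length `m ≤ μ`:
`prf (tabScheme (tablesOf P μ k₁ k₂ k₃ k₄)) μ (tkey i) m x = prf P μ k m x` whenever table `i` is `tableOf P μ k`. [folklore] -/
theorem prf_tablesOf (P : PuncturablePRFScheme) (μ : ℕ) (k₁ k₂ k₃ k₄ : List Bool) (i : Fin 4) (k : List Bool)
    (hk : (tablesOf P μ k₁ k₂ k₃ k₄).tab i = tableOf P μ k) {m : ℕ} (hm : m ≤ μ) (x : List Bool) :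
    prf (tabScheme (tablesOf P μ k₁ k₂ k₃ k₄)) μ (tkey i) m x = prf P μ k m x := by
  rw [prf_tabScheme, hk]
  simp only [tableOf, ofFn_vecOf, fit_fit hm]
  rfl

/-- Table `0` of the generator's tables is the table of `k₁`. [folklore] -/
theorem tablesOf_tab_zero (P : PuncturablePRFScheme) (μ : ℕ) (k₁ k₂ k₃ k₄ : List Bool) :
    (tablesOf P μ k₁ k₂ k₃ k₄).tab 0 = tableOf P μ k₁ := rfl

/-- Table `1` of the generator's tables is the table of `k₂`. [folklore] -/
theorem tablesOf_tab_one (P : PuncturablePRFScheme) (μ : ℕ) (k₁ k₂ k₃ k₄ : List Bool) :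
    (tablesOf P μ k₁ k₂ k₃ k₄).tab 1 = tableOf P μ k₂ := rfl

/-- Table `2` of the generator's tables is the table of `k₃`. [folklore] -/
theorem tablesOf_tab_two (P : PuncturablePRFScheme) (μ : ℕ) (k₁ k₂ k₃ k₄ : List Bool) :
    (tablesOf P μ k₁ k₂ k₃ k₄).tab 2 = tableOf P μ k₃ := rfl

/-- Table `3` of the generator's tables is the table of `k₄`. [folklore] -/
theorem tablesOf_tab_three (P : PuncturablePRFScheme) (μ : ℕ) (k₁ k₂ k₃ k₄ : List Bool) :
    (tablesOf P μ k₁ k₂ k₃ k₄).tab 3 = tableOf P μ k₄ := rfl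

/-- **Naming layer.** With no label truncation (`2d + 3 ≤ μ`) the name string of every vertex computed by the
generator's SIV code over tables `0, 1` of its own tables is the generator's name string. [folklore] -/
theorem vname_tablesOf (P : PuncturablePRFScheme) (μ d : ℕ) (k₁ k₂ k₃ k₄ : List Bool) (hℓ : labelLen d ≤ μ)
    (v : Vertex d) :
    vname (tabScheme (tablesOf P μ k₁ k₂ k₃ k₄)) μ (tkey 0) (tkey 1) d v = vname P μ k₁ k₂ d v := by
  simp only [vname, sivEnc, tag, length_label]
  rw [prf_tablesOf P μ k₁ k₂ k₃ k₄ 0 k₁ (tablesOf_tab_zero P μ k₁ k₂ k₃ k₄) le_rfl,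
    prf_tablesOf P μ k₁ k₂ k₃ k₄ 1 k₂ (tablesOf_tab_one P μ k₁ k₂ k₃ k₄) hℓ]

/-- **Naming layer, as embeddings.** `codeNaming (tablesOf P μ k₁ k₂ k₃ k₄) d = naming P μ k₁ k₂ d` for `2d + 3 ≤ μ`.
[folklore] -/
theorem codeNaming_tablesOf (P : PuncturablePRFScheme) (μ d : ℕ) (k₁ k₂ k₃ k₄ : List Bool) (hℓ : labelLen d ≤ μ) :
    codeNaming (tablesOf P μ k₁ k₂ k₃ k₄) d = naming P μ k₁ k₂ d := by
  ext v : 1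
  apply List.ofFn_injective
  rw [codeNaming, ofFn_naming, ofFn_naming, vname_tablesOf P μ d k₁ k₂ k₃ k₄ hℓ v]

/-- **Cycle layer, round functions.** With `d ≤ μ` the round functions of the generator's Feistel code over table `i`
of its own tables are the generator's round functions at key `kᵢ`. [folklore] -/
theorem roundFn_tablesOf (P : PuncturablePRFScheme) (μ d : ℕ) (k₁ k₂ k₃ k₄ : List Bool) (i : Fin 4) (k : List Bool)
    (hk : (tablesOf P μ k₁ k₂ k₃ k₄).tab i = tableOf P μ k) (hd : d ≤ μ) (r : ℕ) :
    roundFn (tabScheme (tablesOf P μ k₁ k₂ k₃ k₄)) μ (tkey i) d r = roundFn P μ k d r := by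
  funext y j
  simp only [ObfuscatedGluedTrees.roundFn, prf_tablesOf P μ k₁ k₂ k₃ k₄ i k hk hd]

/-- **Cycle layer, leaf permutations.** With `d ≤ μ` the keyed Feistel permutation of the leaf positions computed over
table `i` of the generator's own tables is the generator's `leafPerm` at key `kᵢ`. [folklore] -/
theorem leafPerm_tablesOf (P : PuncturablePRFScheme) (μ d : ℕ) (k₁ k₂ k₃ k₄ : List Bool) (i : Fin 4) (k : List Bool)
    (hk : (tablesOf P μ k₁ k₂ k₃ k₄).tab i = tableOf P μ k) (hd : d ≤ μ) :
    leafPerm (tabScheme (tablesOf P μ k₁ k₂ k₃ k₄)) μ (tkey i) d = leafPerm P μ k d := by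
  unfold leafPerm prp
  simp only [roundFn_tablesOf P μ d k₁ k₂ k₃ k₄ i k hk hd]

/-- **Cycle layer.** `codeCycle (tablesOf P μ k₁ k₂ k₃ k₄) d = cycleOf P μ k₃ k₄ d` for `d ≤ μ`. [folklore] -/
theorem codeCycle_tablesOf (P : PuncturablePRFScheme) (μ d : ℕ) (k₁ k₂ k₃ k₄ : List Bool) (hd : d ≤ μ) :
    codeCycle (tablesOf P μ k₁ k₂ k₃ k₄) d = cycleOf P μ k₃ k₄ d := by
  unfold codeCycle cycleOf
  rw [leafPerm_tablesOf P μ d k₁ k₂ k₃ k₄ 2 k₃ (tablesOf_tab_two P μ k₁ k₂ k₃ k₄) hd,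
    leafPerm_tablesOf P μ d k₁ k₂ k₃ k₄ 3 k₄ (tablesOf_tab_three P μ k₁ k₂ k₃ k₄) hd]

/-- **Stub `stub_codeLink`** (the generator is ideal-model-II code at its own tables): for `2d + 3 ≤ μ` and `d ≤ μ` (so
that no fitting truncates), the generator's naming and cycle datum for keys `k₁..k₄` are the code naming and code cycle
at the four tables `v ↦ F_{kᵢ}(v)` (`prf P μ k m = prf (tabScheme (tablesOf …)) μ (tkey i) m` for `m ≤ μ`).
[cite: ChildsEtAl2003, §2] -/
theorem stub_codeLink : ∀ (P : PuncturablePRFScheme) (μ d : ℕ) (k₁ k₂ k₃ k₄ : List Bool),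
    labelLen d ≤ μ → d ≤ μ →
      naming P μ k₁ k₂ d = codeNaming (tablesOf P μ k₁ k₂ k₃ k₄) d ∧
        cycleOf P μ k₃ k₄ d = codeCycle (tablesOf P μ k₁ k₂ k₃ k₄) d := by
  intro P μ d k₁ k₂ k₃ k₄ hℓ hd
  exact ⟨(codeNaming_tablesOf P μ d k₁ k₂ k₃ k₄ hℓ).symm, (codeCycle_tablesOf P μ d k₁ k₂ k₃ k₄ hd).symm⟩

end Summit.QuantumAdvantage.QuantumAdvantage.Theorems.WbwObfuscatedGluedTrees.KnowledgeOfWalk.RealIdeal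

end
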